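import Summits.AtomisticToContinuum.HydrodynamicLimit.Theorems.StiffCollisionalRelaxationAprioriBoundsMesoCapstones
import Literature.Barriers.AtomisticToContinuum.HighMomentumCutoff
import HarnessLib

/-! # D3 split check (strategist s2, crux stmt-AtomisticToContinuum-14827) — see `D3-SPLIT.md` next to this file.

Scratch: the three children of the D3 split of `CollisionIsometryCLT.AprioriBoundsPreShock`,
rendered exactly as the gate would render them in the route namespace, + the glue by the ACCEPTED capstone
(p147849) and the dedup sanity checks (children 1–2 are the twins of stmt-9201 / stmt-14415 by `Iff.rfl`). -/

namespace Summit.AtomisticToContinuum.HydrodynamicLimit.Cruxes.AprioriBounds.D3Split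

-- published twin of the strategist's folder file `SplitCheck.lean` (there: inside the ROUTE namespace itself, byte-identical otherwise);
-- here in a Cruxes namespace so that the tree never carries two decls named `…Theses.CollisionIsometryCLT.KineticRangeControl` once the split is filed.
open Summit.AtomisticToContinuum.HydrodynamicLimit.Theses.CollisionIsometryCLT (AprioriBoundsPreShock)

open scoped BigOperators Topology Manifold Classical MeasureTheory ProbabilityTheory Matrix InnerProductSpace ComplexConjugate ContinuousMap
open Filter Set Function TopologicalSpace MeasureTheory

/-- child 1 (= stmt-AtomisticToContinuum-9201 verbatim) -/
def KineticRangeControl : Prop :=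
  ∀ η₀ : ℝ, 0 < η₀ → ∀ (a₀ θ₀ : Literature.MathematicalPhysics.KineticTheory.T3 → ℝ) (u₀ : Literature.MathematicalPhysics.KineticTheory.T3 → Literature.MathematicalPhysics.KineticTheory.V3), Continuous a₀ → Continuous θ₀ → Continuous u₀ → (∀ x, 0 < a₀ x) → (∀ x, 0 < θ₀ x) → ∃ σ₀ : ℝ, 0 < σ₀ ∧ ∀ σ : ℝ, 0 < σ → σ < σ₀ → ∀ (T : ℝ) (ρ θ : ℝ → Literature.MathematicalPhysics.KineticTheory.T3 → ℝ) (u : ℝ → Literature.MathematicalPhysics.KineticTheory.T3 → Literature.MathematicalPhysics.KineticTheory.V3), Literature.MathematicalPhysics.KineticTheory.IsHardSphereEulerSolution σ T ρ u θ → (∀ t ∈ Set.Ico 0 T, ∀ x, ρ t x * σ ^ 3 < η₀) → ∀ Φ : (N : ℕ) → Literature.Analysis.FluidPDE.HardSphereFlow (Literature.Analysis.FluidPDE.Torus.geometry (Fin 3)) (Literature.MathematicalPhysics.KineticTheory.hsDiameter σ N) (N + 1), Literature.MathematicalPhysics.KineticTheory.TendstoHydroFieldsAt (fun N => Literature.MathematicalPhysics.KineticTheory.localGibbsLaw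 σ a₀ u₀ θ₀ N (Φ N)) Φ ρ u θ 0 → ∀ (φ : ℕ → Literature.MathematicalPhysics.KineticTheory.T3 → ℝ) (ℓ : ℕ → ℝ), (∀ N, Continuous (φ N)) → (∀ N x, 0 ≤ φ N x) → (∀ N, ∫ x, φ N x = 1) → (∀ N x, ℓ N < Literature.Analysis.FluidPDE.Torus.euclidDist x 0 → φ N x = 0) → (∃ A : ℝ, ∀ N x y, φ N x * ℓ N ^ 3 ≤ A ∧ |φ N x - φ N y| * ℓ N ^ 4 ≤ A * Literature.Analysis.FluidPDE.Torus.euclidDist x y) → (∀ N, 0 < ℓ N) → Filter.Tendsto ℓ Filter.atTop (nhds 0) → Filter.Tendsto (fun N : ℕ => ((N : ℝ) + 1) * ℓ N ^ 3 / Real.log ((N : ℝ) + 2)) Filter.atTop Filter.atTop → ∀ t ∈ Set.Ico 0 T, ∃ c Cρ C : ℝ, 0 < c ∧ Cρ * σ ^ 3 < η₀ ∧ (∀ s ∈ Set.Icc 0 t, ∀ x, c < ρ s x ∧ ρ s x < Cρ ∧ ‖ρ s x • u s x‖ < C ∧ Literature.MathematicalPhysics.KineticTheory.totalEnergyDensity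 (ρ s x) (u s x) (θ s x) < C ∧ c < θ s x) ∧ Filter.Tendsto (fun N : ℕ => Literature.MathematicalPhysics.KineticTheory.localGibbsLaw σ a₀ u₀ θ₀ N (Φ N) {z | let ρℓ := fun s x => Literature.MathematicalPhysics.KineticTheory.empiricalDensityField ((Φ N).flow s z) (fun y => φ N (x - y)); let mℓ := fun s x => Literature.MathematicalPhysics.KineticTheory.empiricalMomentumField ((Φ N).flow s z) (fun y => φ N (x - y)); let Eℓ := fun s x => Literature.MathematicalPhysics.KineticTheory.empiricalEnergyField ((Φ N).flow s z) (fun y => φ N (x - y)); let θℓ := fun s x => 2 / 3 * (Eℓ s x / ρℓ s x - ‖mℓ s x‖ ^ 2 / (2 * ρℓ s x ^ 2)); ∃ s ∈ Set.Icc 0 t, ∃ x, ¬ (c ≤ ρℓ s x ∧ ρℓ s x ≤ Cρ ∧ ‖mℓ s x‖ ≤ C ∧ Eℓ s x ≤ C ∧ c ≤ θℓ s x)}) Filter.atTop (nhds 0)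

/-- child 2 (= stmt-AtomisticToContinuum-14415 verbatim) -/
def GaussianTails : Prop :=
  ∀ (a₀ θ₀ : Literature.MathematicalPhysics.KineticTheory.T3 → ℝ) (u₀ : Literature.MathematicalPhysics.KineticTheory.T3 → Literature.MathematicalPhysics.KineticTheory.V3), Continuous a₀ → Continuous θ₀ → Continuous u₀ → (∀ x, 0 < a₀ x) → (∀ x, 0 < θ₀ x) → ∃ σ₀ : ℝ, 0 < σ₀ ∧ ∀ σ : ℝ, 0 < σ → σ < σ₀ → ∀ (T : ℝ) (ρ θ : ℝ → Literature.MathematicalPhysics.KineticTheory.T3 → ℝ) (u : ℝ → Literature.MathematicalPhysics.KineticTheory.T3 → Literature.MathematicalPhysics.KineticTheory.V3), Literature.MathematicalPhysics.KineticTheory.IsHardSphereEulerSolution σ T ρ u θ → ∀ Φ : (N : ℕ) → Literature.Analysis.FluidPDE.HardSphereFlow (Literature.Analysis.FluidPDE.Torus.geometry (Fin 3)) (Literature.MathematicalPhysics.KineticTheory.hsDiameter σ N) (N + 1), Literature.MathematicalPhysics.KineticTheory.TendstoHydroFieldsAt (fun N => Literature.MathematicalPhysics.KineticTheory.localGibbsLaw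 σ a₀ u₀ θ₀ N (Φ N)) Φ ρ u θ 0 → ∀ t ∈ Set.Ico 0 T, ∃ c : ℝ, 0 < c ∧ ∃ C : ENNReal, C < ⊤ ∧ ∃ N₀ : ℕ, ∀ N : ℕ, N₀ ≤ N → ∀ s ∈ Set.Icc 0 t, (∫⁻ z, Literature.Barriers.AtomisticToContinuum.expVelocityMoment c ((Φ N).flow s z) ∂(Literature.MathematicalPhysics.KineticTheory.localGibbsLaw σ a₀ u₀ θ₀ N (Φ N))) ≤ C

/-- child 3 (NEW: registered stub `stub_occupationVariance`, `frac` inlined) -/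
def OccupationVariance : Prop :=
  ∀ (a₀ θ₀ : Literature.MathematicalPhysics.KineticTheory.T3 → ℝ) (u₀ : Literature.MathematicalPhysics.KineticTheory.T3 → Literature.MathematicalPhysics.KineticTheory.V3), Continuous a₀ → Continuous θ₀ → Continuous u₀ → (∀ x, 0 < a₀ x) → (∀ x, 0 < θ₀ x) → ∃ σ₀ : ℝ, 0 < σ₀ ∧ ∃ η₁ : ℝ, 0 < η₁ ∧ ∀ σ : ℝ, 0 < σ → σ < σ₀ → ∀ (T : ℝ) (ρ θ : ℝ → Literature.MathematicalPhysics.KineticTheory.T3 → ℝ) (u : ℝ → Literature.MathematicalPhysics.KineticTheory.T3 → Literature.MathematicalPhysics.KineticTheory.V3), Literature.MathematicalPhysics.KineticTheory.IsHardSphereEulerSolution σ T ρ u θ → ∀ Φ : (N : ℕ) → Literature.Analysis.FluidPDE.HardSphereFlow (Literature.Analysis.FluidPDE.Torus.geometry (Fin 3)) (Literature.MathematicalPhysics.KineticTheory.hsDiameter σ N) (N + 1), Literature.MathematicalPhysics.KineticTheory.TendstoHydroFieldsAt (fun N => Literature.MathematicalPhysics.KineticTheory.localGibbsLaw σ a₀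 u₀ θ₀ N (Φ N)) Φ ρ u θ 0 → ∀ t : ℝ, 0 < t → t < T → (∀ s ∈ Set.Icc 0 t, ∀ x, 2 * ρ s x * σ ^ 3 < η₁) → ∀ K : ℝ, Filter.Tendsto (fun N : ℕ => ProbabilityTheory.variance (fun z => (∫⁻ s in Set.Icc 0 t, ENNReal.ofReal ((Literature.Analysis.FluidPDE.empiricalMeasure ((Φ N).flow s z) {y | K ≤ ‖y.2‖ ^ 2}).toReal)).toReal) (Literature.MathematicalPhysics.KineticTheory.localGibbsLaw σ a₀ u₀ θ₀ N (Φ N))) Filter.atTop (nhds 0)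

/-- the glue, by the accepted capstone (what `--glue-by` would render) -/
theorem AprioriBoundsPreShockGlueBy_holds :
    KineticRangeControl → GaussianTails → OccupationVariance → AprioriBoundsPreShock :=
  _root_.Summit.AtomisticToContinuum.HydrodynamicLimit.Theorems.MesoChebyshevWindow.AprioriBoundsPreShock_of_KRC_GT_occupationVariance

/-- the glue as a `Prop` item (what `--glue` would render) and its one-line proof -/
def AprioriBoundsPreShockOfSubs : Prop :=
  KineticRangeControl → GaussianTails → OccupationVariance → AprioriBoundsPreShock

theorem aprioriBoundsPreShockOfSubs_proof : AprioriBoundsPreShockOfSubs :=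
  fun h₁ h₂ h₃ =>
    _root_.Summit.AtomisticToContinuum.HydrodynamicLimit.Theorems.MesoChebyshevWindow.AprioriBoundsPreShock_of_KRC_GT_occupationVariance h₁ h₂ h₃

-- dedup sanity: the children are the SAME Props as the existing items' decls
example : KineticRangeControl ↔ _root_.Summit.AtomisticToContinuum.HydrodynamicLimit.Theses.GermanoSplitLES.KineticRangeControl := Iff.rfl
example : GaussianTails ↔ _root_.Summit.AtomisticToContinuum.HydrodynamicLimit.Theses.UGibbsSRBRigidity.GaussianTails := Iff.rfl

-- not vacuous at K ≤ 0 only: the conclusion quantifies over all real K (content for K > 0); probe that nothing cheap closes child 3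
example : OccupationVariance := by
  first
  | exact?
  | sorry

#print axioms AprioriBoundsPreShockGlueBy_holds
#print axioms aprioriBoundsPreShockOfSubs_proof

end Summit.AtomisticToContinuum.HydrodynamicLimit.Cruxes.AprioriBounds.D3Split
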